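import Literature.IUT.HodgeTheaters.PuncturedEllipticCoveringsModLCuspLaws
import Literature.IUT.HodgeTheaters.PuncturedEllipticCoveringsCor12CarrowFromXarrow
import HarnessLib

/-!
# [IUTchI] Cor. 1.2 — the `ι`-law `hι'` of `…Cor12CarrowFromXarrow` from abc-iut-L5-t1's `ModLCuspLaws`
# (L3) — proof-only bridge

Mochizuki, *Inter-universal Teichmüller theory I*, kurims manuscript (May 2020), §1, pp. 37–39
([IUTchI] §1 pp.37–39) [claim: Mochizuki2012, status: disputed].  Node `IUTchI:Cor1.2`; proof-only
companion (no definitions, nothing restated) over abc-iut-L5-t1's FROZEN `PuncturedEllipticCoverings.lean`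
(p404449), `…Cusps.lean` (p424023) and `…ModLCuspLaws.lean` (p446054, the `Δ_ε`-level structure laws), and
the abc-iut-L5-d4 kernels `…XbarRecovery` (p429979), `…Cor12CarrowFromXarrow` (p447384).

WHAT THIS FILE DOES.  The closer of record `InitialThetaData.pe_characteristicNatureOfCoverings_viaX`
(p447384) binds ONE classical law `hι'` at the primed datum, stated on `Δ_X` modulo
`H = Ker(Δ_X ↠ Δ_X^{ab} ⊗ ℤ/lℤ)` (the closed subgroup of the frozen hypothesis (∗) `star`): "an element of
`Δ_C̲ ∖ Δ_X̲` does not centralise `Δ_X^{ab} ⊗ ℤ/lℤ`".  abc-iut-L5-t1's `ModLCuspLaws.iota_neg` (L3) renders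
the same printed sentence — "one verifies immediately that `ι` acts on `Δ_E ⊗ (ℤ/lℤ)` via multiplication by
`−1`" (p. 37 last line – p. 38 l. 1) — on `Δ_X̲` modulo `I_ε′ · I_ε″ · Ker(Δ_X̲ ↠ Δ_ε)`.  Here `hι'` is DERIVED
from (L3) and two further classical-shaped inputs on the same standard objects (hypothesis binders, never
asserted):
* `hIH : ∀ x, I_x ≤ H` — every cusp inertia group of `X̲` dies in `Δ_X^{ab} ⊗ ℤ/lℤ` (the cusps of `X̲` lie
  over the single cusp of `X`, whose inertia is a commutator in `Δ_X ≅ F̂₂`: the (rel)-type law of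
  abc-iut-L5-t1's p438104 / abc-iut-L5-d5's `hI`, RULINGS #60);
* `hXH : ¬ Δ_X̲ ≤ H` — equivalently `H ≠ Δ_X̲`, i.e. `Δ_X^{ab} ⊗ ℤ/lℤ` is not cyclic of order `l`; supplied
  (`not_deltaXbar_le_H_of_relIndex`) by the rank statement `[Δ_X : H] = l²` ("`Δ_X^{ab} ⊗ (ℤ/lℤ)`" of
  (∗), p. 37, is `E[l] ≅ (ℤ/lℤ)²`) given the cusp action and the law `[Π_X : Π_X̲] = l`.
The derivation (`exists_commutator_not_mem_H_of_iotaNeg`): if `c ∈ Δ_C̲ ∖ Δ_X̲` centralised `Δ_X` modulo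
`H`, then for `v ∈ Δ_X̲` both `c v c⁻¹ v⁻¹ ∈ H` and (L3) `c v c⁻¹ v ∈ I_ε′ · I_ε″ · Ker(Δ_X̲ ↠ Δ_ε) ⊆ H`, so
`v² ∈ H`; with `v^l ∈ H` and `l` odd, `v ∈ H` — i.e. `Δ_X̲ ≤ H`.  Main results:
`ModLCuspLaws.exists_commutator_not_mem_H` and the closer
`InitialThetaData.pe_characteristicNatureOfCoverings_viaX_of_laws` (p447384's closer with `hι'` ↦
`ModLCuspLaws` (L3) at the primed datum BY NAME + `hIH'` + `hrank'`).
No side is taken on [IUTchIII] Cor. 3.12; binders are assumption labels; typed ≠ discharged.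
-/

namespace Literature.IUT.HodgeTheaters

namespace PuncturedEllipticData

open scoped Pointwise
open Literature.AnabelianGeometry.AbsoluteAnabelian
open Literature.AnabelianGeometry.AbsoluteAnabelian.FundamentalExtension (CuspidalAlgorithm)
open Literature.AnabelianGeometry.AbsoluteAnabelian.AbsTopII (semiEllipticDoubleCoverSubgroups)

universe u

variable {D : PuncturedEllipticData.{u}}

/-! ### `I_ε′ · I_ε″ · Ker(Δ_X̲ ↠ Δ_ε) ⊆ H` when the cusp inertia groups lie in `H` -/

/-- `Ker(Δ_X̲ ↠ Δ_X̲^{ab} ⊗ ℤ/lℤ) ⊆ H = Ker(Δ_X ↠ Δ_X^{ab} ⊗ ℤ/lℤ)` (`Δ_X̲ ⊆ Δ_X`; commutators, `l`-th powers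
and closures are monotone). ([IUTchI] §1 p.37) [claim: Mochizuki2012, status: disputed] -/
theorem modLKer_le_H (D : PuncturedEllipticData.{u}) :
    D.modLKer ≤ (⁅D.PiX ⊓ D.DeltaC, D.PiX ⊓ D.DeltaC⁆ ⊔ Subgroup.closure
      ((fun y : D.PiC => y ^ D.l) '' (D.PiX ⊓ D.DeltaC : Set D.PiC))).topologicalClosure := by
  refine Subgroup.topologicalClosure_mono (sup_le_sup ?_ ?_)
  · exact Subgroup.commutator_mono deltaXbar_le_deltaX deltaXbar_le_deltaX
  · exact Subgroup.closure_mono (Set.image_mono fun _ hx => deltaXbar_le_deltaX hx)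

/-- If every cusp inertia group lies in `H`, then so does `I_ε′ · I_ε″ · Ker(Δ_X̲ ↠ Δ_ε)`.
([IUTchI] §1 p.37) [claim: Mochizuki2012, status: disputed] -/
theorem inertia_sup_deltaEpsKer_le_H
    (hIH : ∀ x : D.Cusp, D.inertia x ≤ (⁅D.PiX ⊓ D.DeltaC, D.PiX ⊓ D.DeltaC⁆ ⊔ Subgroup.closure
      ((fun y : D.PiC => y ^ D.l) '' (D.PiX ⊓ D.DeltaC : Set D.PiC))).topologicalClosure) :
    D.inertia D.ε1 ⊔ D.inertia D.ε2 ⊔ D.deltaEpsKer ≤ (⁅D.PiX ⊓ D.DeltaC, D.PiX ⊓ D.DeltaC⁆ ⊔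
      Subgroup.closure ((fun y : D.PiC => y ^ D.l) '' (D.PiX ⊓ D.DeltaC : Set D.PiC))).topologicalClosure :=
  sup_le (sup_le (hIH _) (hIH _)) (sup_le D.modLKer_le_H (iSup_le fun x => hIH x.1))

/-- `l` is odd (`l` is prime to `6`): `l + 1 = 2k`. ([IUTchI] §1 p.37) [claim: Mochizuki2012, status: disputed] -/
theorem exists_l_add_one_eq_two_mul (D : PuncturedEllipticData.{u}) : ∃ k : ℕ, D.l + 1 = 2 * k := by
  have h2 : Nat.Coprime D.l 2 := Nat.Coprime.coprime_dvd_right (by norm_num) D.coprime_six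
  have hodd : D.l % 2 = 1 := Nat.odd_iff.mp (Nat.coprime_two_right.mp h2)
  exact ⟨(D.l + 1) / 2, by omega⟩

/-! ### The `ι`-law from (L3) -/

/-- **The law `hι'` of `…Cor12CarrowFromXarrow` from print's "`ι` acts on `Δ_E ⊗ (ℤ/lℤ)` via multiplication
by `−1`" in abc-iut-L5-t1's (L3) shape** (`c v c⁻¹ · v ∈ I_ε′ · I_ε″ · Ker(Δ_X̲ ↠ Δ_ε)` for `c ∈ Δ_C̲ ∖ Δ_X̲`,
`v ∈ Δ_X̲`), GIVEN that the cusp inertia groups lie in `H` (`hIH`) and `Δ_X̲ ⊄ H` (`hXH`): an element of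
`Δ_C̲ ∖ Δ_X̲` does not centralise `Δ_X` modulo `H` [else `v² ∈ H` and `v^l ∈ H` for every `v ∈ Δ_X̲`, so
`Δ_X̲ ⊆ H` as `l` is odd]. ([IUTchI] §1 p.38) [claim: Mochizuki2012, status: disputed] -/
theorem exists_commutator_not_mem_H_of_iotaNeg
    (hL3 : ∀ c ∈ D.DeltaCbar, c ∉ D.DeltaXbar → ∀ v ∈ D.DeltaXbar,
      c * v * c⁻¹ * v ∈ D.inertia D.ε1 ⊔ D.inertia D.ε2 ⊔ D.deltaEpsKer)
    (hIH : ∀ x : D.Cusp, D.inertia x ≤ (⁅D.PiX ⊓ D.DeltaC, D.PiX ⊓ D.DeltaC⁆ ⊔ Subgroup.closure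
      ((fun y : D.PiC => y ^ D.l) '' (D.PiX ⊓ D.DeltaC : Set D.PiC))).topologicalClosure)
    (hXH : ¬ D.DeltaXbar ≤ (⁅D.PiX ⊓ D.DeltaC, D.PiX ⊓ D.DeltaC⁆ ⊔ Subgroup.closure
      ((fun y : D.PiC => y ^ D.l) '' (D.PiX ⊓ D.DeltaC : Set D.PiC))).topologicalClosure) :
    ∀ c ∈ D.DeltaCbar, c ∉ D.DeltaXbar → ∃ v ∈ D.PiX ⊓ D.DeltaC,
      c * v * c⁻¹ * v⁻¹ ∉ (⁅D.PiX ⊓ D.DeltaC, D.PiX ⊓ D.DeltaC⁆ ⊔ Subgroup.closure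
        ((fun y : D.PiC => y ^ D.l) '' (D.PiX ⊓ D.DeltaC : Set D.PiC))).topologicalClosure := by
  intro c hc hcX
  by_contra hall
  simp only [not_exists, not_and, not_not] at hall
  apply hXH
  intro v hv
  have hvX : v ∈ D.PiX ⊓ D.DeltaC := deltaXbar_le_deltaX hv
  -- `[c, v] ∈ H` and `c v c⁻¹ v ∈ H`, hence `v² ∈ H`
  have h1 := hall v hvX
  have h2 := inertia_sup_deltaEpsKer_le_H hIH (hL3 c hc hcX v hv)
  have hsq : v ^ 2 ∈ (⁅D.PiX ⊓ D.DeltaC, D.PiX ⊓ D.DeltaC⁆ ⊔ Subgroup.closure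
      ((fun y : D.PiC => y ^ D.l) '' (D.PiX ⊓ D.DeltaC : Set D.PiC))).topologicalClosure := by
    have e : v ^ 2 = (c * v * c⁻¹ * v⁻¹)⁻¹ * (c * v * c⁻¹ * v) := by rw [pow_two]; group
    rw [e]
    exact Subgroup.mul_mem _ (Subgroup.inv_mem _ h1) h2
  -- `v^l ∈ H`
  have hl : v ^ D.l ∈ (⁅D.PiX ⊓ D.DeltaC, D.PiX ⊓ D.DeltaC⁆ ⊔ Subgroup.closure
      ((fun y : D.PiC => y ^ D.l) '' (D.PiX ⊓ D.DeltaC : Set D.PiC))).topologicalClosure :=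
    Subgroup.le_topologicalClosure _ (Subgroup.mem_sup_right (Subgroup.subset_closure ⟨v, hvX, rfl⟩))
  -- `l + 1 = 2k`: `v = (v²)^k · (v^l)⁻¹`
  obtain ⟨k, hk⟩ := D.exists_l_add_one_eq_two_mul
  have e : v = (v ^ 2) ^ k * (v ^ D.l)⁻¹ := by
    rw [← pow_mul, ← hk, pow_succ]; group
  rw [e]
  exact Subgroup.mul_mem _ (Subgroup.pow_mem _ hsq k) (Subgroup.inv_mem _ hl)

/-- **`hι'` from abc-iut-L5-t1's `ModLCuspLaws` (field (L3) `iota_neg`) BY NAME**, given `hIH` and `hXH`.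
([IUTchI] §1 p.38) [claim: Mochizuki2012, status: disputed] -/
theorem ModLCuspLaws.exists_commutator_not_mem_H (L : D.ModLCuspLaws)
    (hIH : ∀ x : D.Cusp, D.inertia x ≤ (⁅D.PiX ⊓ D.DeltaC, D.PiX ⊓ D.DeltaC⁆ ⊔ Subgroup.closure
      ((fun y : D.PiC => y ^ D.l) '' (D.PiX ⊓ D.DeltaC : Set D.PiC))).topologicalClosure)
    (hXH : ¬ D.DeltaXbar ≤ (⁅D.PiX ⊓ D.DeltaC, D.PiX ⊓ D.DeltaC⁆ ⊔ Subgroup.closure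
      ((fun y : D.PiC => y ^ D.l) '' (D.PiX ⊓ D.DeltaC : Set D.PiC))).topologicalClosure) :
    ∀ c ∈ D.DeltaCbar, c ∉ D.DeltaXbar → ∃ v ∈ D.PiX ⊓ D.DeltaC,
      c * v * c⁻¹ * v⁻¹ ∉ (⁅D.PiX ⊓ D.DeltaC, D.PiX ⊓ D.DeltaC⁆ ⊔ Subgroup.closure
        ((fun y : D.PiC => y ^ D.l) '' (D.PiX ⊓ D.DeltaC : Set D.PiC))).topologicalClosure :=
  exists_commutator_not_mem_H_of_iotaNeg L.iota_neg hIH hXH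

/-! ### `Δ_X̲ ⊄ H` from the rank of `Δ_X^{ab} ⊗ ℤ/lℤ` -/

/-- `H ⊆ Δ_X̲` given the cusp action and the law `[Π_X : Π_X̲] = l` (`H ⊆ Π_X̲`, p429979, and `H ⊆ Δ_X ⊆ Δ_C`).
([IUTchI] Cor 1.2 p.39) [claim: Mochizuki2012, status: disputed] -/
theorem CuspGalois.H_le_deltaXbar (C : D.CuspGalois) (hX : D.PiXbar.relIndex D.PiX = D.l) :
    (⁅D.PiX ⊓ D.DeltaC, D.PiX ⊓ D.DeltaC⁆ ⊔ Subgroup.closure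
      ((fun y : D.PiC => y ^ D.l) '' (D.PiX ⊓ D.DeltaC : Set D.PiC))).topologicalClosure ≤ D.DeltaXbar := by
  haveI := D.normal_deltaX
  refine le_inf (C.H_le_piXbar hX) ?_
  refine Subgroup.topologicalClosure_minimal _ (sup_le ?_ ?_) ?_
  · exact (Subgroup.commutator_le_right _ _).trans inf_le_right
  · rw [Subgroup.closure_le]
    rintro _ ⟨y, hy, rfl⟩
    exact D.DeltaC.pow_mem (Subgroup.mem_inf.mp hy).2 D.l
  · exact D.E.isClosed_geom

/-- **`Δ_X̲ ⊄ H` from "`Δ_X^{ab} ⊗ (ℤ/lℤ) ≅ (ℤ/lℤ)²`"** in the index form `[Δ_X : H] = l²`, given the cusp action and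
the law `[Π_X : Π_X̲] = l` [else `H = Δ_X̲`, of index `l ≠ l²` in `Δ_X`]. ([IUTchI] §1 p.37)
[claim: Mochizuki2012, status: disputed] -/
theorem CuspGalois.not_deltaXbar_le_H_of_relIndex (C : D.CuspGalois) (hX : D.PiXbar.relIndex D.PiX = D.l)
    (hrank : (⁅D.PiX ⊓ D.DeltaC, D.PiX ⊓ D.DeltaC⁆ ⊔ Subgroup.closure
      ((fun y : D.PiC => y ^ D.l) '' (D.PiX ⊓ D.DeltaC : Set D.PiC))).topologicalClosure.relIndex
        (D.PiX ⊓ D.DeltaC) = D.l ^ 2) :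
    ¬ D.DeltaXbar ≤ (⁅D.PiX ⊓ D.DeltaC, D.PiX ⊓ D.DeltaC⁆ ⊔ Subgroup.closure
      ((fun y : D.PiC => y ^ D.l) '' (D.PiX ⊓ D.DeltaC : Set D.PiC))).topologicalClosure := by
  intro hle
  have heq := le_antisymm hle (C.H_le_deltaXbar hX)
  rw [← heq, relIndex_deltaXbar_deltaX_of_hX hX] at hrank
  have h5 := D.five_le
  have : D.l * 1 < D.l * D.l := Nat.mul_lt_mul_of_pos_left (by omega) (by omega)
  rw [mul_one, ← sq] at this
  omega

end PuncturedEllipticData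

/-! ### The closer of record with `hι'` supplied from `ModLCuspLaws` -/

namespace InitialThetaData

open scoped Pointwise
open Literature.AnabelianGeometry.AbsoluteAnabelian
open Literature.AnabelianGeometry.AbsoluteAnabelian.FundamentalExtension (CuspidalAlgorithm)
open Literature.AnabelianGeometry.AbsoluteAnabelian.AbsTopII (semiEllipticDoubleCoverSubgroups)

universe u u'

variable {F : Type u} {K : Type} {Fbar : Type} [Field F] [NumberField F] [Field K] [NumberField K]
  [Algebra F K] [Field Fbar] [Algebra F Fbar] [Algebra K Fbar]
  {E : WeierstrassCurve F} [E.IsElliptic] {l : ℕ} {Pb : BadPlacePredicates K}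
  (D : InitialThetaData F K Fbar E l Pb)
  {F' : Type u'} {K' : Type} [Field F'] [NumberField F'] [Field K'] [NumberField K'] [Algebra F' K']
  {Fbar' : Type} [Field Fbar'] [Algebra F' Fbar'] [Algebra K' Fbar']
  {E' : WeierstrassCurve F'} [E'.IsElliptic] {l' : ℕ} {Pb' : BadPlacePredicates K'}
  (D' : InitialThetaData F' K' Fbar' E' l' Pb')

/-- **[IUTchI] Cor. 1.2 between the `K`-level data of two initial Θ-data over number fields** — the closer
`pe_characteristicNatureOfCoverings_viaX` (p447384) with the `ι`-law `hι'` SUPPLIED from abc-iut-L5-t1's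
`ModLCuspLaws` at the primed datum ((L3) `iota_neg` BY NAME) together with `hIH'` (cusp inertia dies in
`Δ'_X^{ab} ⊗ ℤ/lℤ`) and `hrank'` (`[Δ'_X : H'] = l'²`).  Other binders as there: `ArrowCoveringClaims` ×2,
`CuspGalois` ×2 (data), ramification of `ε⁰` ×2, `GeomTFG` ×2, `htf`, `huniq'`, `hext`, `hextC`, `A` +
`RecoversCusps` ×2; no `hLem45C`. ([IUTchI] Cor 1.2 p.39) [claim: Mochizuki2012, status: disputed] -/
theorem pe_characteristicNatureOfCoverings_viaX_of_laws (h : D.geom.pe.ArrowCoveringClaims)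
    (h' : D'.geom.pe.ArrowCoveringClaims) (C : D.geom.pe.CuspGalois) (C' : D'.geom.pe.CuspGalois)
    (h0 : ¬ D.geom.pe.inertia D.geom.pe.ε0 ≤ D.geom.pe.piXarrow)
    (h0' : ¬ D'.geom.pe.inertia D'.geom.pe.ε0 ≤ D'.geom.pe.piXarrow)
    (hΔ : D.geom.pe.E.GeomTFG) (hΔ' : D'.geom.pe.E.GeomTFG)
    (htf : IsMulTorsionFree ↥(D.geom.pe.PiX ⊓ D.geom.pe.DeltaC))
    (huniq' : ∀ J ∈ semiEllipticDoubleCoverSubgroups D'.geom.pe.E,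
      J ⊓ D'.geom.pe.DeltaC = D'.geom.pe.PiX ⊓ D'.geom.pe.DeltaC)
    (hext : ∀ φ : D.geom.pe.piXarrow ≃* D'.geom.pe.piXarrow, Continuous φ → Continuous φ.symm →
      ∃ Θ : D.geom.pe.PiC ≃ₜ* D'.geom.pe.PiC,
        ∀ x : D.geom.pe.piXarrow, Θ (x : D.geom.pe.PiC) = (φ x : D'.geom.pe.PiC))
    (hextC : ∀ ψ : D.geom.pe.piCarrow ≃* D'.geom.pe.piCarrow, Continuous ψ → Continuous ψ.symm →
      ∃ Θ : D.geom.pe.PiC ≃ₜ* D'.geom.pe.PiC,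
        ∀ x : D.geom.pe.piCarrow, Θ (x : D.geom.pe.PiC) = (ψ x : D'.geom.pe.PiC))
    (A : CuspidalAlgorithm.{0}) (hA : A.RecoversCusps D.geom.pe.extXbar C.cuspidalDataXbar)
    (hA' : A.RecoversCusps D'.geom.pe.extXbar C'.cuspidalDataXbar)
    (L' : D'.geom.pe.ModLCuspLaws)
    (hIH' : ∀ x : D'.geom.pe.Cusp, D'.geom.pe.inertia x ≤
      (⁅D'.geom.pe.PiX ⊓ D'.geom.pe.DeltaC, D'.geom.pe.PiX ⊓ D'.geom.pe.DeltaC⁆ ⊔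
        Subgroup.closure ((fun y : D'.geom.pe.PiC => y ^ D'.geom.pe.l) ''
          (D'.geom.pe.PiX ⊓ D'.geom.pe.DeltaC : Set D'.geom.pe.PiC))).topologicalClosure)
    (hrank' : (⁅D'.geom.pe.PiX ⊓ D'.geom.pe.DeltaC, D'.geom.pe.PiX ⊓ D'.geom.pe.DeltaC⁆ ⊔
        Subgroup.closure ((fun y : D'.geom.pe.PiC => y ^ D'.geom.pe.l) ''
          (D'.geom.pe.PiX ⊓ D'.geom.pe.DeltaC : Set D'.geom.pe.PiC))).topologicalClosure.relIndex
        (D'.geom.pe.PiX ⊓ D'.geom.pe.DeltaC) = D'.geom.pe.l ^ 2) :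
    D.geom.pe.CharacteristicNatureOfCoverings D'.geom.pe :=
  D.pe_characteristicNatureOfCoverings_viaX D' h h' C C' h0 h0' hΔ hΔ' htf huniq' hext hextC A hA hA'
    (L'.exists_commutator_not_mem_H hIH'
      (C'.not_deltaXbar_le_H_of_relIndex D'.pe_relIndex_piXbar_piX hrank'))

end InitialThetaData

end Literature.IUT.HodgeTheaters
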